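import Literature.AlgebraicGeometry.Frobenioids.EndomorphismsNonExpanding
import Literature.AlgebraicGeometry.Frobenioids.ElementaryIsFrobenioid
import Literature.AlgebraicGeometry.Frobenioids.PiNatMonoid
import Literature.AlgebraicGeometry.Frobenioids.DivIdentityPrimeRays
import Mathlib.CategoryTheory.SingleObj
import HarnessLib

/-!
# Frobenioids I, Prop. 1.12 (ii)–(iv) fail in a NON-DILATING Frobenioid; the repair hypotheses (H) fail there too

Mochizuki, *The geometry of Frobenioids I*, Kyushu J. Math. **62** (2008), §1, Prop. 1.12 (ii)–(iv), kurims p. 39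
[cite: MochizukiFrdI2008, Prop. 1.12 p.39]; Def. 1.1 (i)/(ii) "non-dilating", p. 17.  Context: Mochizuki, *The étale
theta function …*, Publ. RIMS **45** (2009), Prop. 3.2 (i) PDF p. 70 ("`DIV_+(Z_∞^log)^pf` may be naturally identified
with a direct PRODUCT of copies of `ℚ_{≥0}`, indexed by the cusps and irreducible components of the special fiber"),
Def. 3.3 (iii) p. 73, Prop. 3.4 (i) p. 74 ("every endomorphism of `Φ₀(Y^log)` … induced by an endomorphism of `Y^log`
over `X^log` is non-dilating") [cite: MochizukiEtTh2009, Prop 3.2 p.70].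

KERNEL COMPANION (abc-iut cell, block F, seat abc-iut-f-039 gen 2; FACT-LIST rows F-1076 `AutFixesDiv`, F-1077
`AutSaturatedIffStatement`, F-1078 `EndoIsSubAutomorphismIffStatement`; referee item P12-NE of abc-iut-L1-lead).
§1–§5 adapted from the RQ7 audit scratch `HOME/staging/L1/L6-t17/Prop112NonDilatingCounterexample.lean` of
abc-iut-L6-t17 (2026-08-25, never filed), re-targeted at the LANDED statements of `Endomorphisms.lean`; §6 is new.
Statements of other files are untouched and not restated.

THE EXAMPLE.  `D = B(ℤ)` (one object `⋆`, `Aut(⋆) = ℤ`); `Φ(⋆) = ℕ^ℤ` = ALL functions `ℤ → ℕ`, pointwise (DIVISORIAL),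
`n ∈ ℤ` acting by the shift `x ↦ (i ↦ x (i + n))` — the shape of the divisor monoid of [EtTh] §3 at a `ℤ`-covering
(effective Cartier log-divisors on a chain of components indexed by `ℤ`; any `ℕ`-combination is locally finite; deck
transformations translate).  Every shift is NON-DILATING ([FrdI] Def. 1.1: for `n ≠ 0` the premise "`b^*(a) ≼ a` for
all primary `a`" fails at `a = 𝟙_{{0}}`).  With `b = 1`, `x = 𝟙_{[0,∞)}`, `δ = 𝟙_{{-1}}`: `b^* x = x + δ`, so for
`φ = (id, x, 1)`, `β = (b, 0, 1) ∈ Aut(⋆)`, `α = (b, δ, 1)` one has `φ ∘ β = α ∘ φ`: `α` is a linear base-isomorphic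
SUB-AUTOMORPHISM with `Div(α) = δ ≠ 0` — not isometric, not an automorphism; `⋆` is `Aut^sub`-ample over an
`Aut`-saturated base and not `Aut`-saturated.  PROVED (`F := ElemFrobenioid.toChar Φ`): `IsFrobenioid F` ([FrdI]
Prop. 1.5 (i)), `IsNonDilatingOn Φ`, the NEGATIONS at `(F, ⋆)` of the four clauses typed in `Endomorphisms.lean`, and
(§6, new) `¬ IsAutNonExpandingOn Φ` (ruling P12-NE: `x ∣ b^* x ≠ x`) and `¬ AutFixesDiv F`: both repair hypotheses of
the cell FAIL for a non-dilating divisorial `Φ`, so "non-dilating" (what [EtTh] Prop. 3.4 (i) secures) does not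
repair Prop. 1.12 (ii)–(iv), and the tree's instance forms (`…_of_finite_aut`, `…_of_isAutNonExpandingOn`, `…_arith`,
`…_Cpt`) do not reach bases carrying a `ℤ` of deck transformations.

HONEST FRAMING: a kernel-checked example about the statements AS TYPED here; what extra hypothesis the author intends
is not decided; Prop. 1.12 is not cited by [IUTchI–IV] or [EtTh] (cell census) — nothing in the cone under
[IUTchIII] Cor. 3.12 depends on it; no side taken on Cor. 3.12.  Monoids multiplicative.
-/

namespace Literature.AlgebraicGeometry.Frobenioids

open CategoryTheory Opposite

namespace EndomorphismsNonDilatingWitness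

/-! ### §1 The data: `D = B(ℤ)`, `Φ(⋆) = ℕ^ℤ` with the shift action -/

/-- The group `ℤ`, written multiplicatively. [cite: MochizukiFrdI2008, Prop. 1.12 p.39] -/
abbrev G : Type := Multiplicative ℤ

/-- The base category `D = B(ℤ)`: one object `⋆` with `End(⋆) = Aut(⋆) = ℤ`. [cite: MochizukiFrdI2008, Prop. 1.12 p.39] -/
abbrev D : Type := SingleObj G

/-- The divisor monoid `ℕ^ℤ` (all functions `ℤ → ℕ`, pointwise addition), written multiplicatively — the shape of
`Div_+(Z_∞^log)` at a chain of components indexed by `ℤ`. [cite: MochizukiEtTh2009, Prop 3.2 p.70] -/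
abbrev M : Type := Multiplicative (ℤ → ℕ)

/-- Shift by `n` on `ℤ → ℕ` (additive form). [cite: MochizukiFrdI2008, Prop. 1.12 p.39] -/
def shiftAddHom (n : ℤ) : (ℤ → ℕ) →+ (ℤ → ℕ) where
  toFun x i := x (i + n)
  map_zero' := rfl
  map_add' _ _ := rfl

/-- Values of `shiftAddHom`. [cite: MochizukiFrdI2008, Prop. 1.12 p.39] -/
@[simp] theorem shiftAddHom_apply (n : ℤ) (x : ℤ → ℕ) (i : ℤ) : shiftAddHom n x i = x (i + n) := rfl

/-- Shift by `n` on `M = ℕ^ℤ` (multiplicative form). [cite: MochizukiFrdI2008, Prop. 1.12 p.39] -/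
def shiftHom (n : ℤ) : M →* M := AddMonoidHom.toMultiplicative (shiftAddHom n)

/-- Values of `shiftHom`. [cite: MochizukiFrdI2008, Prop. 1.12 p.39] -/
@[simp] theorem toAdd_shiftHom_apply (n : ℤ) (x : M) (i : ℤ) :
    Multiplicative.toAdd (shiftHom n x) i = Multiplicative.toAdd x (i + n) := rfl

/-- `shift 0 = id`. [cite: MochizukiFrdI2008, Prop. 1.12 p.39] -/
theorem shiftHom_zero : shiftHom 0 = MonoidHom.id M := by
  refine MonoidHom.ext fun x => ?_
  apply Multiplicative.toAdd.injective
  funext i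
  simp

/-- `shift (a + b) = shift b ∘ shift a`. [cite: MochizukiFrdI2008, Prop. 1.12 p.39] -/
theorem shiftHom_add (a b : ℤ) : shiftHom (a + b) = (shiftHom b).comp (shiftHom a) := by
  refine MonoidHom.ext fun x => ?_
  apply Multiplicative.toAdd.injective
  funext i
  simp only [toAdd_shiftHom_apply, MonoidHom.comp_apply]
  rw [show i + b + a = i + (a + b) by omega]

/-- Every shift is bijective (inverse: the opposite shift). [cite: MochizukiFrdI2008, Prop. 1.12 p.39] -/
theorem shiftHom_bijective (n : ℤ) : Function.Bijective (shiftHom n) := by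
  have h1 : Function.LeftInverse (shiftHom (-n)) (shiftHom n) := fun x => by
    show (shiftHom (-n)).comp (shiftHom n) x = x
    rw [← shiftHom_add, add_neg_cancel, shiftHom_zero]
    rfl
  have h2 : Function.RightInverse (shiftHom (-n)) (shiftHom n) := fun x => by
    show (shiftHom n).comp (shiftHom (-n)) x = x
    rw [← shiftHom_add, neg_add_cancel, shiftHom_zero]
    rfl
  exact ⟨h1.injective, h2.surjective⟩

/-- The monoid `Φ` on `D`: `⋆ ↦ ℕ^ℤ`, the arrow `n ∈ ℤ` acting by the shift by `n` (an `abbrev`, so that `Φ(⋆)`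
unfolds to `M`). [cite: MochizukiFrdI2008, Def. 1.1(ii) p.17] -/
abbrev Φ : Dᵒᵖ ⥤ CommMonCat.{0} where
  obj _ := CommMonCat.of M
  map f := CommMonCat.ofHom (shiftHom (Multiplicative.toAdd f.unop))
  map_id X := by
    rw [unop_id, SingleObj.id_as_one, toAdd_one, shiftHom_zero]
    rfl
  map_comp f g := by
    rw [unop_comp, SingleObj.comp_as_mul, toAdd_mul, shiftHom_add]
    rfl

/-- The pull-back maps of `Φ` are the shifts. [cite: MochizukiFrdI2008, Def. 1.1(ii) p.17] -/
theorem pull_Φ_eq {X Y : D} (g : X ⟶ Y) : pull Φ g = shiftHom (Multiplicative.toAdd g) := rfl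

/-- The object `⋆` of `F_Φ`. [cite: MochizukiFrdI2008, Def. 1.1(iii) p.17] -/
def A : ElemFrobenioid Φ := ElemFrobenioid.of Φ (SingleObj.star G)

/-- Elements of `G = ℤ` as base arrows of `⋆`. [cite: MochizukiFrdI2008, Def. 1.1(iii) p.17] -/
def baseHom (g : G) : A.base ⟶ A.base := g

/-- `(g, 0, 1)` is an automorphism of `⋆` in `F_Φ`, with inverse `(g⁻¹, 0, 1)`. [cite: MochizukiFrdI2008, Def. 1.1(iii) p.17] -/
def baseIso (g : G) : A ≅ A where
  hom := ElemFrobenioid.homMk (baseHom g) 1 1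
  inv := ElemFrobenioid.homMk (baseHom g⁻¹) 1 1
  hom_inv_id := by
    refine ElemFrobenioid.Hom.ext ?_ ?_ ?_
    · show g⁻¹ * g = (1 : G)
      exact inv_mul_cancel g
    · show pull Φ (baseHom g) 1 * 1 ^ ((1 : ℕ+) : ℕ) = 1
      rw [map_one, one_pow, mul_one]
    · rfl
  inv_hom_id := by
    refine ElemFrobenioid.Hom.ext ?_ ?_ ?_
    · show g * g⁻¹ = (1 : G)
      exact mul_inv_cancel g
    · show pull Φ (baseHom g⁻¹) 1 * 1 ^ ((1 : ℕ+) : ℕ) = 1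
      rw [map_one, one_pow, mul_one]
    · rfl

/-- `x = 𝟙_{[0,∞)}` — an effective divisor with infinite (locally finite) support. [cite: MochizukiEtTh2009, Prop 3.2 p.70] -/
def ind : ℤ → ℕ := fun i => if 0 ≤ i then 1 else 0

/-- `δ = 𝟙_{{-1}}` — one component. [cite: MochizukiEtTh2009, Prop 3.2 p.70] -/
def dlt : ℤ → ℕ := fun i => if i = -1 then 1 else 0

/-- `x` as an element of `M`. [cite: MochizukiFrdI2008, Prop. 1.12 p.39] -/
def xDiv : M := Multiplicative.ofAdd ind

/-- `δ` as an element of `M`. [cite: MochizukiFrdI2008, Prop. 1.12 p.39] -/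
def dDiv : M := Multiplicative.ofAdd dlt

/-- `δ(-1) = 1`. [cite: MochizukiFrdI2008, Prop. 1.12 p.39] -/
@[simp] theorem toAdd_dDiv_neg_one : Multiplicative.toAdd dDiv (-1) = 1 := by
  show dlt (-1) = 1
  simp [dlt]

/-- `b^* x = δ + x` for the generator `b = 1 ∈ ℤ`: translating `𝟙_{[0,∞)}` by one step ENLARGES it by one
component. [cite: MochizukiFrdI2008, Prop. 1.12 p.39] -/
theorem shift_ind : shiftAddHom 1 ind = dlt + ind := by
  funext i
  simp only [shiftAddHom_apply, Pi.add_apply, ind, dlt]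
  split_ifs <;> omega

/-- `shift 1 (x) = δ · x` in `M`. [cite: MochizukiFrdI2008, Prop. 1.12 p.39] -/
theorem shiftHom_one_xDiv : shiftHom 1 xDiv = dDiv * xDiv := by
  apply Multiplicative.toAdd.injective
  rw [toAdd_mul]
  exact shift_ind

/-- `b^* x = δ · x` in `Φ(⋆)`. [cite: MochizukiFrdI2008, Prop. 1.12 p.39] -/
theorem pull_b_xDiv : pull Φ (baseHom (Multiplicative.ofAdd 1)) xDiv = dDiv * xDiv :=
  shiftHom_one_xDiv

/-- `φ = (id, x, 1) : ⋆ → ⋆`. [cite: MochizukiFrdI2008, Prop. 1.12 p.39] -/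
def φ : A ⟶ A := ElemFrobenioid.homMk (𝟙 _) xDiv 1

/-- `β = (b, 0, 1) ∈ Aut(⋆)`, `b = 1 ∈ ℤ`. [cite: MochizukiFrdI2008, Prop. 1.12 p.39] -/
def β : A ≅ A := baseIso (Multiplicative.ofAdd 1)

/-- `α = (b, δ, 1) : ⋆ → ⋆`. [cite: MochizukiFrdI2008, Prop. 1.12 p.39] -/
def α : A ⟶ A := ElemFrobenioid.homMk (baseHom (Multiplicative.ofAdd 1)) dDiv 1

/-- `φ ∘ β = α ∘ φ` (zero divisors: `b^* x + 0 = δ + x = id^* δ + x`). [cite: MochizukiFrdI2008, Prop. 1.12 p.39] -/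
theorem sq : β.hom ≫ φ = φ ≫ α := by
  refine ElemFrobenioid.Hom.ext ?_ ?_ ?_
  · show baseHom (Multiplicative.ofAdd 1) ≫ 𝟙 A.base = 𝟙 A.base ≫ baseHom (Multiplicative.ofAdd 1)
    rw [Category.comp_id, Category.id_comp]
  · show pull Φ (baseHom (Multiplicative.ofAdd 1)) xDiv * 1 ^ ((1 : ℕ+) : ℕ)
        = pull Φ (𝟙 A.base) dDiv * xDiv ^ ((1 : ℕ+) : ℕ)
    rw [pull_b_xDiv, pull_id, one_pow, mul_one, PNat.one_coe, pow_one]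
  · rfl

/-- `α` is a sub-automorphism of `⋆` ([FrdI] §0), witnessed by `φ`, `β`. [cite: MochizukiFrdI2008, Prop. 1.12 p.39] -/
theorem isSubAutomorphism_α : IsSubAutomorphism EndomorphismsNonDilatingWitness.α := ⟨A, φ, β, sq⟩

/-! ### §2 `α` against the Frobenioid structure `F_Φ → F_{Φ^char}` -/

/-- The functor `F_Φ → F_{Φ^char}` of [FrdI] Prop. 1.5 (i). [cite: MochizukiFrdI2008, Prop. 1.5(i) p.25] -/
abbrev F : ElemFrobenioid Φ ⥤ ElemFrobenioid (charFunctor Φ) := ElemFrobenioid.toChar Φ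

/-- `α` is a base-isomorphism (`D` is a groupoid). [cite: MochizukiFrdI2008, Prop. 1.12 p.39] -/
theorem isBaseIso_α : PreFrobenioid.IsBaseIso F α := by
  show IsIso (PreFrobenioid.Base F α)
  infer_instance

/-- `δ` is not a unit of `ℕ^ℤ`. [cite: MochizukiFrdI2008, Prop. 1.12 p.39] -/
theorem not_isUnit_dDiv : ¬ IsUnit dDiv := by
  intro h
  obtain ⟨c, hc⟩ := h.exists_right_inv
  have h1 := congrArg (fun z : M => Multiplicative.toAdd z (-1)) hc
  simp only [toAdd_mul, toAdd_one, Pi.add_apply, Pi.zero_apply, toAdd_dDiv_neg_one] at h1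
  omega

/-- `α` is NOT isometric (`Div(α) = δ ≠ 0`). [cite: MochizukiFrdI2008, Prop. 1.12(ii) p.39] -/
theorem not_isIsometry_α : ¬ PreFrobenioid.IsIsometry F α := by
  intro h
  have h' : Associates.mk dDiv = 1 := h
  exact not_isUnit_dDiv (Associates.mk_eq_one.mp h')

/-- `α` is NOT an automorphism (an inverse would need a divisor `y` with `b^* y + δ = 0`). [cite: MochizukiFrdI2008, Prop. 1.12(iii) p.39] -/
theorem not_isIso_α : ¬ IsIso EndomorphismsNonDilatingWitness.α := by
  intro h
  have hdiv := congrArg ElemFrobenioid.Hom.div (IsIso.hom_inv_id α)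
  have h' : shiftHom 1 (ElemFrobenioid.Hom.div (inv α)) *
      dDiv ^ ((ElemFrobenioid.Hom.degFr (inv α) : ℕ+) : ℕ) = (1 : M) := hdiv
  have h1 := congrArg (fun z : M => Multiplicative.toAdd z (-1)) h'
  simp only [toAdd_mul, toAdd_pow, toAdd_one, Pi.add_apply, Pi.smul_apply, smul_eq_mul,
    Pi.zero_apply, toAdd_dDiv_neg_one, mul_one] at h1
  have hpos : 0 < ((ElemFrobenioid.Hom.degFr (inv α) : ℕ+) : ℕ) := PNat.pos _
  omega

/-- The base `⋆ ∈ Ob(D)` is `Aut`-saturated (every arrow of `D` is invertible). [cite: MochizukiFrdI2008, Prop. 1.12(iv) p.39] -/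
theorem isAutSaturatedObj_base : IsAutSaturatedObj (PreFrobenioid.baseObj F A) :=
  fun _ _ => inferInstance

/-- `⋆ ∈ Ob(F_Φ)` is `Aut^sub`-ample: `g ∈ Aut_D(⋆)` lifts to the automorphism `(g, 0, 1)`. [cite: MochizukiFrdI2008, Prop. 1.12(iv) p.39] -/
theorem isAutSubAmple_A : PreFrobenioid.IsAutSubAmple F A := by
  intro f _
  exact ⟨(baseIso f).hom, mem_autSub_of_isIso _, rfl⟩

/-- `⋆ ∈ Ob(F_Φ)` is NOT `Aut`-saturated (`α`). [cite: MochizukiFrdI2008, Prop. 1.12(iv) p.39] -/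
theorem not_isAutSaturatedObj_A : ¬ IsAutSaturatedObj EndomorphismsNonDilatingWitness.A := fun h =>
  not_isIso_α (h α isSubAutomorphism_α)

/-! ### §3 The example satisfies the hypotheses of [FrdI] Prop. 1.5 (i): it is a Frobenioid -/

/-- `ℕ^ℤ` is divisorial (tree: `PiNat.isDivisorial`, the full product `∏_J ℤ≥0` of [EtTh] Prop. 3.2 (i)); in
particular pre-divisorial. [cite: MochizukiFrdI2008, Def. 1.1(i) p.17] -/
theorem isPreDivisorial_M : IsPreDivisorial M := (PiNat.isDivisorial (J := ℤ)).isPreDivisorial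

/-- `Φ` is a monoid on `D` (Def. 1.1 (ii)): pull-backs are characteristically injective and bijective.
[cite: MochizukiFrdI2008, Def. 1.1(ii) p.17] -/
theorem isMonoidOn_Φ : IsMonoidOn EndomorphismsNonDilatingWitness.Φ where
  isCharInjective g := by
    rw [pull_Φ_eq]
    exact ⟨(shiftHom_bijective _).injective,
      associatesMap_injective_of_isSharp PiNat.isSharp (shiftHom_bijective _).injective⟩
  bijective_of_isFSM g _ := by
    rw [pull_Φ_eq]
    exact shiftHom_bijective _

/-- `Φ` is objectwise pre-divisorial. [cite: MochizukiFrdI2008, Def. 1.1(ii) p.17] -/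
theorem objectwise_isPreDivisorial : Objectwise (fun N _ => IsPreDivisorial N) EndomorphismsNonDilatingWitness.Φ :=
  fun _ => isPreDivisorial_M

/-- `Φ` is objectwise divisorial. [cite: MochizukiFrdI2008, Def. 1.1(ii) p.17] -/
theorem objectwise_isDivisorial : Objectwise (fun N _ => IsDivisorial N) EndomorphismsNonDilatingWitness.Φ :=
  fun _ => PiNat.isDivisorial

/-- `D` is totally epimorphic (a groupoid). [cite: MochizukiFrdI2008, §0 p.10] -/
theorem isTotallyEpimorphic_D : IsTotallyEpimorphic D := ⟨fun _ => inferInstance⟩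

/-- `D` is connected (one object). [cite: MochizukiFrdI2008, §0 p.10] -/
theorem isGraphConnected_D : IsGraphConnected D :=
  ⟨⟨SingleObj.star G⟩, fun X Y => by
    obtain rfl : X = Y := Subsingleton.elim _ _
    exact Relation.ReflTransGen.refl⟩

/-- `F_Φ → F_{Φ^char}` is a Frobenioid ([FrdI] Prop. 1.5 (i)). [cite: MochizukiFrdI2008, Prop. 1.5(i) p.25] -/
theorem isFrobenioid_F : PreFrobenioid.IsFrobenioid F :=
  ElemFrobenioid.isFrobenioid_toChar isMonoidOn_Φ objectwise_isPreDivisorial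
    isGraphConnected_D isTotallyEpimorphic_D

/-! ### §4 `Φ` is non-dilating ([FrdI] Def. 1.1 (i), (ii)) -/

/-- Shifts permute the coordinate vectors: `shift n (e_k) = e_{k-n}` (`e_k = 𝟙_{{k}}`, tree `PiNat.single k 1`).
[cite: MochizukiFrdI2008, Def. 1.1(i) p.17] -/
theorem shiftHom_single (n k : ℤ) : shiftHom n (PiNat.single k 1) = PiNat.single (k - n) 1 := by
  refine PiNat.ext fun i => ?_
  show (Pi.single k 1 : ℤ → ℕ) (i + n) = (Pi.single (k - n) 1 : ℤ → ℕ) i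
  simp only [Pi.single_apply]
  split_ifs <;> omega

/-- For a shift `n ≠ 0`, `shift n (e₀) = e_{-n}` is not `≼ e₀` (an element `≼ e₀` is supported at `0`).
[cite: MochizukiFrdI2008, §0 p.12] -/
theorem not_precsim_shift_single_zero {n : ℤ} (hn : n ≠ 0) : ¬ PiNat.single (0 - n) 1 ≼ PiNat.single (0 : ℤ) 1 := by
  intro h
  have h1 := PiNat.eq_single_of_precsim_single h
  rw [PiNat.coeff_single_of_ne (show (0 : ℤ) ≠ 0 - n by omega), PiNat.single_zero, PiNat.single_eq_one_iff] at h1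
  exact one_ne_zero h1

/-- Every shift is non-dilating on `ℕ^ℤ` ([FrdI] Def. 1.1 (i)): for `n = 0` it is the identity; for `n ≠ 0` the
premise "`b^*(a) ≼ a` for all primary `a`" fails at the primary `e₀` (`PiNat.isPrimary_single`).
[cite: MochizukiFrdI2008, Def. 1.1(i) p.17] -/
theorem isNonDilating_shiftHom (n : ℤ) : IsNonDilating (shiftHom n) := by
  intro hprem
  by_cases hn : n = 0
  · subst hn
    rw [shiftHom_zero]
    refine MonoidHom.ext fun a => ?_
    obtain ⟨a, rfl⟩ := Associates.mk_surjective a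
    rw [associatesMap_mk]
    rfl
  · exfalso
    have h := hprem _ ((isPrimary_associatesMk_iff PiNat.isSharp).mpr (PiNat.isPrimary_single (0 : ℤ) one_ne_zero))
    rw [associatesMap_mk, shiftHom_single, precsim_associatesMk_iff] at h
    exact not_precsim_shift_single_zero hn h

/-- `Φ` is non-dilating ([FrdI] Def. 1.1 (ii)) — as [EtTh] Prop. 3.4 (i) asserts for `Φ₀`.
[cite: MochizukiFrdI2008, Def. 1.1(ii) p.17] -/
theorem isNonDilatingOn_Φ : IsNonDilatingOn EndomorphismsNonDilatingWitness.Φ :=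
  fun _ g => isNonDilating_shiftHom (Multiplicative.toAdd g)

/-! ### §5 The printed clauses of Prop. 1.12 (ii)–(iv), as typed in `Endomorphisms.lean`, fail at `(F, ⋆)` -/

/-- The printed necessity of Prop. 1.12 (ii) ("a sub-automorphism is isometric") fails for the non-dilating
Frobenioid `F_Φ → F_{Φ^char}` at `⋆`. [cite: MochizukiFrdI2008, Prop. 1.12(ii) p.39] -/
theorem not_subAutomorphismIsIsometryStatement : ¬ PreFrobenioid.SubAutomorphismIsIsometryStatement F A :=
  fun h => not_isIsometry_α (h α isSubAutomorphism_α)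

/-- Prop. 1.12 (ii) as printed fails for `F_Φ → F_{Φ^char}` at `⋆`. [cite: MochizukiFrdI2008, Prop. 1.12(ii) p.39] -/
theorem not_endoIsSubAutomorphismIffStatement : ¬ PreFrobenioid.EndoIsSubAutomorphismIffStatement F A :=
  fun h => not_isIsometry_α ((h α).mp isSubAutomorphism_α).1

/-- The printed sufficiency of Prop. 1.12 (iii) fails for `F_Φ → F_{Φ^char}` at `⋆`. [cite: MochizukiFrdI2008, Prop. 1.12(iii) p.39] -/
theorem not_subAutomorphismIsIsoIffStatement : ¬ PreFrobenioid.SubAutomorphismIsIsoIffStatement F A :=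
  fun h => not_isIso_α ((h α isSubAutomorphism_α).mpr isBaseIso_α)

/-- Prop. 1.12 (iv) as printed fails for `F_Φ → F_{Φ^char}` at `⋆`. [cite: MochizukiFrdI2008, Prop. 1.12(iv) p.39] -/
theorem not_autSaturatedIffStatement : ¬ PreFrobenioid.AutSaturatedIffStatement F A :=
  fun h => not_isAutSaturatedObj_A ((h isAutSubAmple_A).mpr isAutSaturatedObj_base)

/-! ### §6 The repair hypotheses (H) fail here although `Φ` is non-dilating -/

/-- **(H) of ruling P12-NE fails**: `x ∣ b^* x = δ · x` but `b^* x ≠ x` — the deck transformation STRICTLY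
ENLARGES the divisor `𝟙_{[0,∞)}`. [cite: MochizukiFrdI2008, Prop. 1.12(ii) p.39] -/
theorem not_isAutNonExpandingOn : ¬ IsAutNonExpandingOn EndomorphismsNonDilatingWitness.Φ := by
  intro hH
  have hdvd : xDiv ∣ pull Φ ((PreFrobenioid.baseFunctor F).mapIso β).hom xDiv := by
    show xDiv ∣ shiftHom 1 xDiv
    rw [shiftHom_one_xDiv]
    exact Dvd.intro_left dDiv rfl
  have hfix : shiftHom 1 xDiv = xDiv := hH ((PreFrobenioid.baseFunctor F).mapIso β) xDiv hdvd
  rw [shiftHom_one_xDiv] at hfix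
  have h1 := congrArg (fun z : M => Multiplicative.toAdd z (-1)) hfix
  simp only [toAdd_mul, Pi.add_apply, toAdd_dDiv_neg_one] at h1
  omega

/-- **(H) `AutFixesDiv` of abc-iut-L1-t1 fails** for `F_Φ → F_{Φ^char}` (else Prop. 1.12 (ii) would hold at `⋆`).
[cite: MochizukiFrdI2008, Prop. 1.12(ii) p.39] -/
theorem not_autFixesDiv : ¬ PreFrobenioid.AutFixesDiv F := fun hH =>
  not_endoIsSubAutomorphismIffStatement (PreFrobenioid.endoIsSubAutomorphismIffStatement_of_autFixesDiv isFrobenioid_F hH A)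

/-- **Summary (new kernel datum for referee item P12-NE).**  There is a Frobenioid whose divisor monoid is
divisorial AND NON-DILATING ([FrdI] Def. 1.1 (i), (ii)) — of the shape `ℕ^ℤ` with deck-translations of
[EtTh] Prop. 3.2 (i) / Def. 3.3 (iii) / Prop. 3.4 (i) — with an object at which the printed necessity of
Prop. 1.12 (ii), Prop. 1.12 (ii) itself, the sufficiency of Prop. 1.12 (iii) and Prop. 1.12 (iv) all FAIL as typed,
and for which both repair hypotheses of the cell, `IsAutNonExpandingOn Φ` and `AutFixesDiv F`, FAIL.  Hence
"non-dilating" does not repair Prop. 1.12 (ii)–(iv). [cite: MochizukiFrdI2008, Prop. 1.12 p.39] -/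
theorem exists_isFrobenioid_isNonDilatingOn_not_prop112 :
    ∃ (Ψ : Dᵒᵖ ⥤ CommMonCat.{0}) (X : ElemFrobenioid Ψ),
      PreFrobenioid.IsFrobenioid (ElemFrobenioid.toChar Ψ) ∧ Objectwise (fun N _ => IsDivisorial N) Ψ ∧
      IsNonDilatingOn Ψ ∧ ¬ IsAutNonExpandingOn Ψ ∧ ¬ PreFrobenioid.AutFixesDiv (ElemFrobenioid.toChar Ψ) ∧
      ¬ PreFrobenioid.SubAutomorphismIsIsometryStatement (ElemFrobenioid.toChar Ψ) X ∧
      ¬ PreFrobenioid.EndoIsSubAutomorphismIffStatement (ElemFrobenioid.toChar Ψ) X ∧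
      ¬ PreFrobenioid.SubAutomorphismIsIsoIffStatement (ElemFrobenioid.toChar Ψ) X ∧
      ¬ PreFrobenioid.AutSaturatedIffStatement (ElemFrobenioid.toChar Ψ) X :=
  ⟨Φ, A, isFrobenioid_F, objectwise_isDivisorial, isNonDilatingOn_Φ, not_isAutNonExpandingOn, not_autFixesDiv,
    not_subAutomorphismIsIsometryStatement, not_endoIsSubAutomorphismIffStatement,
    not_subAutomorphismIsIsoIffStatement, not_autSaturatedIffStatement⟩

/-- The universal closures of rows F-1077 / F-1078 fail EVEN among Frobenioids with non-dilating divisorial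
divisor monoid (sharpening `PreFrobenioid.not_forall_isFrobenioid_endoIsSubAutomorphismIffStatement` of
`EndomorphismsHolds.lean`, whose witness is dilating). [cite: MochizukiFrdI2008, Prop. 1.12(ii) p.39] -/
theorem not_forall_isNonDilatingOn_endoIsSubAutomorphismIffStatement :
    ¬ ∀ (Ψ : Dᵒᵖ ⥤ CommMonCat.{0}) (X : ElemFrobenioid Ψ),
      PreFrobenioid.IsFrobenioid (ElemFrobenioid.toChar Ψ) → IsNonDilatingOn Ψ →
        PreFrobenioid.EndoIsSubAutomorphismIffStatement (ElemFrobenioid.toChar Ψ) X :=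
  fun h => not_endoIsSubAutomorphismIffStatement (h Φ A isFrobenioid_F isNonDilatingOn_Φ)

end EndomorphismsNonDilatingWitness

end Literature.AlgebraicGeometry.Frobenioids
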